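import Summits.ResolutionOfSingularities.ResolutionOfSingularities.Theorems.FrobeniusLadderFRationalResolutionSuspensionSingularLocus
import Summits.ResolutionOfSingularities.ResolutionOfSingularities.Theorems.FrobeniusLadderFRationalResolutionSpecHypersurface
import Summits.ResolutionOfSingularities.ResolutionOfSingularities.Theorems.FrobeniusLadderFRationalResolutionQuadricConeResolution
import Literature.AlgebraicGeometry.Resolution.AffineBlowup
import HarnessLib

/-!
# The `A_n` surfaces `{yz + x^(n+1) = 0}` are regular away from the origin

Support file for crux stmt-ResolutionOfSingularities-15317 (`FrobeniusLadder.FRationalResolution`),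
line `Sketch`, continuation seat c3: first assembly piece of the `A_m` PROGRAMME for rung 4′
(resolve the whole family `Aₙ = Spec k[y,z,x]/(yz + x^(n+1))` of members of the residual class by
the tower of point blow-ups, every field `k`). Here: the open complement
`Uₙ = D(ȳ) ∪ D(z̄) ∪ D(x̄)` of the origin is a DENSE open all of whose local rings are REGULAR.

* `aeval_suspensionPow_eq_zero_*`, `X_inl_zero_notMem_span_suspensionPow`, … — the classes of
  `y`, `z`, `x` are non-zero in `k[y,z,x]/(yz + x^(n+1))` (evaluate at `k[t]`-points of the surface);
* `An_notMem_or_of_X_inr_notMem` — a prime of `k[y,z,x]` through the surface missing `x` misses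
  `y` or `z` (`x^(n+1) = g − yz`);
* `An_isRegularLocalRing_stalk_of_notMem` — at every point of `Uₙ` the stalk is a regular local
  ring (c2's Jacobian lemma `suspension_isRegularLocalRing_of_notMem` through the stalk
  presentation `𝒪 ≅ S_P/(g)` of `nonempty_stalk_ringEquiv_localization_quotient`);
* `An_dense_offOrigin` — `Uₙ` is dense (`D(ȳ)` is, the ring being a domain).

All folklore; no published fact is used.
-/

-- single-problem summit: the doubled namespace component is forced
set_option linter.dupNamespace false

noncomputable section

namespace Summit.ResolutionOfSingularities.ResolutionOfSingularities.Theorems.FRationalResolution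

open CategoryTheory AlgebraicGeometry TopologicalSpace MvPolynomial
open Literature.AlgebraicGeometry.Resolution

section AnOffOrigin

variable (k : Type) [Field k] (n : ℕ)

/-- The `k[t]`-point `(y, z, x) = (t, 0, 0)` of `{yz + x^(n+1) = 0}`: the evaluation kills the
equation. [folklore] -/
theorem aeval_suspensionPow_eq_zero_inl_zero :
    aeval (Sum.elim ![(Polynomial.X : Polynomial k), 0] ![(0 : Polynomial k)])
      (X (Sum.inl 0) * X (Sum.inl 1) + rename Sum.inr (X 0 ^ (n + 1)) :
        MvPolynomial (Fin 2 ⊕ Fin 1) k) = 0 := by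
  simp

/-- The `k[t]`-point `(y, z, x) = (0, t, 0)` of `{yz + x^(n+1) = 0}`. [folklore] -/
theorem aeval_suspensionPow_eq_zero_inl_one :
    aeval (Sum.elim ![(0 : Polynomial k), Polynomial.X] ![(0 : Polynomial k)])
      (X (Sum.inl 0) * X (Sum.inl 1) + rename Sum.inr (X 0 ^ (n + 1)) :
        MvPolynomial (Fin 2 ⊕ Fin 1) k) = 0 := by
  simp

/-- The `k[t]`-point `(y, z, x) = (1, −t^(n+1), t)` of `{yz + x^(n+1) = 0}`. [folklore] -/
theorem aeval_suspensionPow_eq_zero_inr :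
    aeval (Sum.elim ![(1 : Polynomial k), -Polynomial.X ^ (n + 1)] ![(Polynomial.X : Polynomial k)])
      (X (Sum.inl 0) * X (Sum.inl 1) + rename Sum.inr (X 0 ^ (n + 1)) :
        MvPolynomial (Fin 2 ⊕ Fin 1) k) = 0 := by
  simp

/-- A polynomial with a non-vanishing value at a point of the surface is not a multiple of the
equation. [folklore] -/
theorem notMem_span_of_aeval_ne_zero {A : Type} [CommRing A] [Algebra k A]
    (v : Fin 2 ⊕ Fin 1 → A) (g q : MvPolynomial (Fin 2 ⊕ Fin 1) k) (hg : aeval v g = 0)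
    (hq : aeval v q ≠ 0) : q ∉ Ideal.span {g} := by
  intro h
  obtain ⟨r, rfl⟩ := Ideal.mem_span_singleton'.mp h
  exact hq (by rw [map_mul, hg, mul_zero])

/-- `y ∉ (yz + x^(n+1))`. [folklore] -/
theorem X_inl_zero_notMem_span_suspensionPow :
    (X (Sum.inl 0) : MvPolynomial (Fin 2 ⊕ Fin 1) k) ∉ Ideal.span
      {(X (Sum.inl 0) * X (Sum.inl 1) + rename Sum.inr (X 0 ^ (n + 1)) :
        MvPolynomial (Fin 2 ⊕ Fin 1) k)} :=
  notMem_span_of_aeval_ne_zero k _ _ _ (aeval_suspensionPow_eq_zero_inl_zero k n)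
    (by simp [Polynomial.X_ne_zero])

/-- `z ∉ (yz + x^(n+1))`. [folklore] -/
theorem X_inl_one_notMem_span_suspensionPow :
    (X (Sum.inl 1) : MvPolynomial (Fin 2 ⊕ Fin 1) k) ∉ Ideal.span
      {(X (Sum.inl 0) * X (Sum.inl 1) + rename Sum.inr (X 0 ^ (n + 1)) :
        MvPolynomial (Fin 2 ⊕ Fin 1) k)} :=
  notMem_span_of_aeval_ne_zero k _ _ _ (aeval_suspensionPow_eq_zero_inl_one k n)
    (by simp [Polynomial.X_ne_zero])

/-- `x ∉ (yz + x^(n+1))`. [folklore] -/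
theorem X_inr_notMem_span_suspensionPow :
    (X (Sum.inr 0) : MvPolynomial (Fin 2 ⊕ Fin 1) k) ∉ Ideal.span
      {(X (Sum.inl 0) * X (Sum.inl 1) + rename Sum.inr (X 0 ^ (n + 1)) :
        MvPolynomial (Fin 2 ⊕ Fin 1) k)} :=
  notMem_span_of_aeval_ne_zero k _ _ _ (aeval_suspensionPow_eq_zero_inr k n)
    (by simp [Polynomial.X_ne_zero])

/-- A prime through `{yz + x^(n+1) = 0}` which misses `x` misses `y` or `z`
(`x^(n+1) = g − yz ∈ P` otherwise). [folklore] -/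
theorem An_notMem_or_of_X_inr_notMem (P : Ideal (MvPolynomial (Fin 2 ⊕ Fin 1) k)) [P.IsPrime]
    (hgP : (X (Sum.inl 0) * X (Sum.inl 1) + rename Sum.inr (X 0 ^ (n + 1)) :
      MvPolynomial (Fin 2 ⊕ Fin 1) k) ∈ P)
    (hx : (X (Sum.inr 0) : MvPolynomial (Fin 2 ⊕ Fin 1) k) ∉ P) :
    (X (Sum.inl 0) : MvPolynomial (Fin 2 ⊕ Fin 1) k) ∉ P ∨
      (X (Sum.inl 1) : MvPolynomial (Fin 2 ⊕ Fin 1) k) ∉ P := by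
  by_contra h
  rw [not_or, not_not, not_not] at h
  obtain ⟨hy, hz⟩ := h
  have hpow : (X (Sum.inr 0) : MvPolynomial (Fin 2 ⊕ Fin 1) k) ^ (n + 1) ∈ P := by
    have h1 : (rename Sum.inr (X 0 ^ (n + 1)) : MvPolynomial (Fin 2 ⊕ Fin 1) k) =
        X (Sum.inr 0) ^ (n + 1) := by
      rw [map_pow, rename_X]
    have h2 : (X (Sum.inl 0) * X (Sum.inl 1) + rename Sum.inr (X 0 ^ (n + 1)) :
        MvPolynomial (Fin 2 ⊕ Fin 1) k) - X (Sum.inl 0) * X (Sum.inl 1) ∈ P :=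
      P.sub_mem hgP (P.mul_mem_right _ hy)
    rwa [add_sub_cancel_left, h1] at h2
  exact hx (Ideal.IsPrime.mem_of_pow_mem inferInstance _ hpow)

end AnOffOrigin

section AnOffOrigin2

/-- **`Aₙ` is regular away from the origin.** For every field `k`, every `n` and every point `p` of
`Aₙ = Spec k[y,z,x]/(yz + x^(n+1))` at which one of `ȳ, z̄, x̄` is a unit, the local ring `𝒪_{Aₙ,p}`
is a regular local ring. [folklore; Jacobian criterion] -/
theorem An_isRegularLocalRing_stalk_of_notMem (k : Type) [Field k] (n : ℕ)
    (p : Spec (CommRingCat.of (MvPolynomial (Fin 2 ⊕ Fin 1) k ⧸ Ideal.span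
      {(MvPolynomial.X (Sum.inl 0) * MvPolynomial.X (Sum.inl 1) + MvPolynomial.rename Sum.inr (MvPolynomial.X 0 ^ (n + 1)) :
        MvPolynomial (Fin 2 ⊕ Fin 1) k)})))
    (hp : Ideal.Quotient.mk _ (MvPolynomial.X (Sum.inl 0)) ∉ p.asIdeal ∨
      Ideal.Quotient.mk _ (MvPolynomial.X (Sum.inl 1)) ∉ p.asIdeal ∨
      Ideal.Quotient.mk _ (MvPolynomial.X (Sum.inr 0)) ∉ p.asIdeal) :
    IsRegularLocalRing ((Spec (CommRingCat.of (MvPolynomial (Fin 2 ⊕ Fin 1) k ⧸ Ideal.span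
      {(MvPolynomial.X (Sum.inl 0) * MvPolynomial.X (Sum.inl 1) + MvPolynomial.rename Sum.inr (MvPolynomial.X 0 ^ (n + 1)) :
        MvPolynomial (Fin 2 ⊕ Fin 1) k)}))).presheaf.stalk p) := by
  haveI hPprime : (p.asIdeal.comap (Ideal.Quotient.mk (Ideal.span
      {(X (Sum.inl 0) * X (Sum.inl 1) + rename Sum.inr (X 0 ^ (n + 1)) :
        MvPolynomial (Fin 2 ⊕ Fin 1) k)}))).IsPrime := Ideal.comap_isPrime _ _
  have hgP : (X (Sum.inl 0) * X (Sum.inl 1) + rename Sum.inr (X 0 ^ (n + 1)) :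
      MvPolynomial (Fin 2 ⊕ Fin 1) k) ∈ p.asIdeal.comap (Ideal.Quotient.mk (Ideal.span
      {(X (Sum.inl 0) * X (Sum.inl 1) + rename Sum.inr (X 0 ^ (n + 1)) :
        MvPolynomial (Fin 2 ⊕ Fin 1) k)})) := by
    rw [Ideal.mem_comap, Ideal.Quotient.eq_zero_iff_mem.mpr (Ideal.mem_span_singleton_self _)]
    exact zero_mem _
  have hyz : (X (Sum.inl 0) : MvPolynomial (Fin 2 ⊕ Fin 1) k) ∉
      p.asIdeal.comap (Ideal.Quotient.mk (Ideal.span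
        {(X (Sum.inl 0) * X (Sum.inl 1) + rename Sum.inr (X 0 ^ (n + 1)) :
          MvPolynomial (Fin 2 ⊕ Fin 1) k)})) ∨
      (X (Sum.inl 1) : MvPolynomial (Fin 2 ⊕ Fin 1) k) ∉
      p.asIdeal.comap (Ideal.Quotient.mk (Ideal.span
        {(X (Sum.inl 0) * X (Sum.inl 1) + rename Sum.inr (X 0 ^ (n + 1)) :
          MvPolynomial (Fin 2 ⊕ Fin 1) k)})) := by
    rcases hp with h | h | h
    · exact Or.inl fun h' => h h'
    · exact Or.inr fun h' => h h'
    · exact An_notMem_or_of_X_inr_notMem k n _ hgP fun h' => h h'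
  have hreg := suspension_isRegularLocalRing_of_notMem k 1 (X 0 ^ (n + 1)) _ hgP hyz
  obtain ⟨e⟩ := nonempty_stalk_ringEquiv_localization_quotient _ _ p _ rfl
  haveI := hreg
  exact IsRegularLocalRing.of_ringEquiv e.symm

variable (k : Type) [Field k] (n : ℕ)

/-- **The complement of the origin is dense in `Aₙ`**: already `D(ȳ)` is (the coordinate ring is
a domain and `ȳ ≠ 0`). [folklore] -/
theorem An_dense_basicOpen_X_inl_zero :
    Dense ((PrimeSpectrum.basicOpen (Ideal.Quotient.mk (Ideal.span
      {(X (Sum.inl 0) * X (Sum.inl 1) + rename Sum.inr (X 0 ^ (n + 1)) :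
        MvPolynomial (Fin 2 ⊕ Fin 1) k)}) (X (Sum.inl 0))) :
      TopologicalSpace.Opens (PrimeSpectrum (MvPolynomial (Fin 2 ⊕ Fin 1) k ⧸ Ideal.span
        {(X (Sum.inl 0) * X (Sum.inl 1) + rename Sum.inr (X 0 ^ (n + 1)) :
          MvPolynomial (Fin 2 ⊕ Fin 1) k)}))) :
      Set (PrimeSpectrum (MvPolynomial (Fin 2 ⊕ Fin 1) k ⧸ Ideal.span
        {(X (Sum.inl 0) * X (Sum.inl 1) + rename Sum.inr (X 0 ^ (n + 1)) :
          MvPolynomial (Fin 2 ⊕ Fin 1) k)}))) := by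
  haveI : (Ideal.span {(X (Sum.inl 0) * X (Sum.inl 1) + rename Sum.inr (X 0 ^ (n + 1)) :
      MvPolynomial (Fin 2 ⊕ Fin 1) k)}).IsPrime :=
    isPrime_span_suspension k 1 (X 0 ^ (n + 1)) (pow_ne_zero _ (X_ne_zero 0))
  haveI : IsDomain (MvPolynomial (Fin 2 ⊕ Fin 1) k ⧸ Ideal.span
      {(X (Sum.inl 0) * X (Sum.inl 1) + rename Sum.inr (X 0 ^ (n + 1)) :
        MvPolynomial (Fin 2 ⊕ Fin 1) k)}) := Ideal.Quotient.isDomain _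
  refine dense_basicOpen_of_ne_zero _ fun h0 => ?_
  exact X_inl_zero_notMem_span_suspensionPow k n (Ideal.Quotient.eq_zero_iff_mem.mp h0)

end AnOffOrigin2

end Summit.ResolutionOfSingularities.ResolutionOfSingularities.Theorems.FRationalResolution

end
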